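import Summits.HubbardSuperconductivity.HubbardSuperconductivity.Theorems.AnisotropyChordTransferFibre3FinX3Eval

/-!
# Route `AnisotropyChord` / H0 rotor rung: FIN per-`L` GM₃ (X5), `L = 27` — rows `N₁` / D / side-condition cell facts, part `p57`

Kernel facts (`decide +kernel`) for cert cells 133, 134 of the per-`L` grid of `L = 27`: `xbnCellAny2` (row `N₁` on XB2 point wedges recomputed in the kernel, exporting the literal brackets `nt ⊇ T⁺ − 3λ₂` and `tb ⊇ T⁺·D`), `xdCellAnyN0` (row D, reads `nt`), `sdCellAnyZN` (side condition, reads `nt`); evaluators `…FinX3Eval` / `…FinX5Eval`; constants from the compiled design probe (x3probe/x3plan, margins c ×0.985, b ×1.03, aD ×1.03); assembled in `…FinX5GM3TwentySeven`.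
Prover seat `hubbard-h0-rotor-p3` g8; helper for piece A = stmt-HubbardSuperconductivity-23918 of rung 19089 (`--supports`, helper class).
WHAT THIS IS NOT: nothing here proves superconductivity in the Hubbard model (rotor TARGET as worded stays FALSE, g15 verdict); kernel facts for the FIN certificate of ONE conditional reduction.  Tree imports only; zero data; standard axioms.
-/

set_option linter.dupNamespace false
set_option autoImplicit false

namespace Summit.HubbardSuperconductivity.HubbardSuperconductivity.Theorems.AnisotropyChord.Transfer.Fibre3

namespace FinXD

open FinXB FinCell Hole2

set_option maxHeartbeats 4000000 in
/-- row `N₁` of cell 133 of `L = 27` (`c = 14/25`), exporting `nt`, `tb`. [folklore] -/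
theorem xn27_133 : xbnCellAny2 27 (49/50 : ℚ) 1956455761333066 2005367155366393 (14/25 : ℚ) ((43811860758993 : ℤ), (66970127518360 : ℤ)) ((5913143320983264 : ℤ), (6083107417392466 : ℤ)) = true := by decide +kernel

set_option maxHeartbeats 4000000 in
/-- row D of cell 133 of `L = 27` (`aD = 19/250`). [folklore] -/
theorem xd27_133 : xdCellAnyN0 27 (49/50 : ℚ) 1956455761333066 2005367155366393 (19/250 : ℚ) ((43811860758993 : ℤ), (66970127518360 : ℤ)) = true := by decide +kernel

set_option maxHeartbeats 4000000 in
/-- side condition of cell 133 of `L = 27` (`c, b = 123/100, aD`). [folklore] -/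
theorem sd27_133 : sdCellAnyZN 27 (49/50 : ℚ) 100 1956455761333066 2005367155366393 ((14/25 : ℚ), (123 : ℕ), (19/250 : ℚ)) ((43811860758993 : ℤ), (66970127518360 : ℤ)) = true := by decide +kernel

set_option maxHeartbeats 4000000 in
/-- row `N₁` of cell 134 of `L = 27` (`c = 14/25`), exporting `nt`, `tb`. [folklore] -/
theorem xn27_134 : xbnCellAny2 27 (49/50 : ℚ) 2005367155366393 2055501334250553 (14/25 : ℚ) ((46866780082323 : ℤ), (71704793929644 : ℤ)) ((6062931526812202 : ℤ), (6238245516050603 : ℤ)) = true := by decide +kernel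

set_option maxHeartbeats 4000000 in
/-- row D of cell 134 of `L = 27` (`aD = 19/250`). [folklore] -/
theorem xd27_134 : xdCellAnyN0 27 (49/50 : ℚ) 2005367155366393 2055501334250553 (19/250 : ℚ) ((46866780082323 : ℤ), (71704793929644 : ℤ)) = true := by decide +kernel

set_option maxHeartbeats 4000000 in
/-- side condition of cell 134 of `L = 27` (`c, b = 126/100, aD`). [folklore] -/
theorem sd27_134 : sdCellAnyZN 27 (49/50 : ℚ) 100 2005367155366393 2055501334250553 ((14/25 : ℚ), (126 : ℕ), (19/250 : ℚ)) ((46866780082323 : ℤ), (71704793929644 : ℤ)) = true := by decide +kernel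

end FinXD

end Summit.HubbardSuperconductivity.HubbardSuperconductivity.Theorems.AnisotropyChord.Transfer.Fibre3
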